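import Literature.NumberTheory.LFunctions.MertensConjectureDisproofNumerics
import HarnessLib

/-!
# One-sided Mertens bounds: RH, simplicity of the zeros, and `rh.S22` from Table 3 alone

Topic `Literature/NumberTheory/LFunctions` (summit `RiemannHypothesis`; inventory id rh.S22:
`Literature.NumberTheory.LFunctions.odlyzko_te_riele_limsup`, `Literature.NumberTheory.LFunctions.odlyzko_te_riele_liminf`,
`Literature.NumberTheory.LFunctions.not_mertens_conjecture` of `RHWave0.lean`). Fourth file of the Odlyzko–te Riele cluster,
after `MertensConjectureDisproof.lean` (architecture, named facts),
`MertensConjectureDisproofProofs.lean` (the kernel theorem and the Jurkat–Peyerimhoff kernel,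
proved) and `MertensConjectureDisproofNumerics.lean` (Table 3 as the named fact
`Literature.NumberTheory.LFunctions.OdlyzkoTeRiele1985_table3`, assembled with Brent's zero verification
`Literature.NumberTheory.LFunctions.Brent1979_zerosSimpleOnLine`).

This file proves §2, p. 141 of

* A. M. Odlyzko, H. J. J. te Riele, *Disproof of the Mertens conjecture*, J. reine angew. Math.
  **357** (1985), 138–160 [OdlyzkoTeRiele1985],

and uses it to remove the zero verification from the hypotheses of rh.S22. The printed argument:
the integral representation (2.1), `1/(sζ(s)) = ∫_1^∞ M(x) x^{-s-1} dx`, converges absolutely on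
`σ > ½` under the Mertens bound, "this would imply that `ζ(s)` has no zeros in `σ > ½`", and
"(2.2) `|1/ζ(s)| ≤ |s| ∫_1^∞ x^{1/2} x^{-σ-1} dx = |s|/(σ - ½)`. This would imply that the zeta
function does not have any multiple zeros, since if `σ = ½ + iγ` were a zero of multiplicity `k`,
then for some constant `a > 0`, `|ζ(½ + u + iγ)| ~ a u^k` as `u → 0⁺`, which is inconsistent
with (2.2) for `k ≥ 2`. … the assumption that `|M(x)| < A x^{1/2}` for any fixed `A` and all
`x ≥ 1` would have sufficed. Furthermore, it has been shown [18], [44] that the Riemann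
hypothesis and the simplicity of the zeros … follow from any one of … (i)
`limsup M(x) x^{-1/2} < A`, (ii) `liminf M(x) x^{-1/2} > -A`."

We prove the one-sided version directly: if `η M(x) ≤ A √x` for `x ≥ x₁` (`η = ±1`), then
Landau's theorem for `M` (`integrableOn_mertens_rpow_of_oneSided`, `MertensOneSided.lean`) gives
(2.1) on `Re s > ½` (`mellin_mertens_eq_of_integrable`), hence no zeros there, and writing
`M = ηA√x - ηg` with `g = A√x - ηM ≥ 0` — whose transform is dominated by its value at the real
point `σ = Re s`, namely `A/(σ - ½) - η/(σζ(σ))` — gives the substitute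
`‖1/(sζ(s))‖ ≤ 2A/(σ - ½) + |1/(σζ(σ))|` for (2.2) (`norm_inv_zeta_le_of_oneSided`); a zero of
`ζ'` at a zero `ρ = ½ + iγ` of `ζ` would force `‖ζ(ρ + u)‖ ≤ C u²`, contradicting this bound as
`u → 0⁺`. Consequently the zero clause of the kernel theorem ("the zeros with `0 < β < 1`,
`|γ| < T` are simple and on the line") holds at *every* height under the negation of either
conclusion of rh.S22, and the three rh.S22 statements follow from the named fact
`OdlyzkoTeRiele1985_table3` alone (`odlyzko_te_riele_limsup_of_table3'`,
`odlyzko_te_riele_liminf_of_table3'`, `not_mertens_conjecture_of_table3'`): the only input of the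
printed disproof not proved in the tree is the certified evaluation of `h_K(y)` at the two `y` of
Table 3 (2000 zeros of `ζ` to 100 digits).

## Main results (namespace `Literature.RH`, all proved)

* `norm_inv_zeta_le_of_mertens_bound` — (2.2) as printed: `|M(x)| ≤ √x` (`x ≥ 1`) gives
  `‖1/ζ(s)‖ ≤ ‖s‖/(Re s - ½)` for `Re s > ½`, `s ≠ 1`.
* `norm_inv_zeta_le_of_oneSided` — the one-sided substitute for (2.2).
* `zetaZero_re_eq_half_of_oneSided` — a one-sided bound implies RH (strip form).
* `zetaZeros_simple_onLine_of_oneSided` — … and the simplicity of all zeros: the zero clause of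
  `OdlyzkoTeRiele1985_kernelTheorem` / `OdlyzkoTeRiele1985_numerics` at every height;
  `zetaZeros_simple_onLine_of_mertensConjecture` — the two-sided special case of §2.
* `OdlyzkoTeRiele1985_numerics_of_table3_of_oneSided`, `odlyzko_te_riele_limsup_of_table3'`,
  `odlyzko_te_riele_liminf_of_table3'`, `not_mertens_conjecture_of_table3'` — rh.S22 from
  `OdlyzkoTeRiele1985_table3` alone.
* `odlyzko_te_riele_limsup_of_conditional`, `odlyzko_te_riele_liminf_of_conditional`,
  `not_mertens_conjecture_of_conditional` — the residual input in its weakest form: values of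
  `Re h_K(y)` certified *under* the assumption that all zeros in the strip are on the line and
  simple (for `not_mertens_conjecture`, any `|Re h_K(y)| > 1` at any height `T > 0`).

## References

* [OdlyzkoTeRiele1985] §2, (2.1)–(2.2), pp. 140–141, hypotheses (i)–(ii) p. 141; §1 p. 139;
  §4.3 Table 3 p. 155.
* [BatemanDiamond2004] P. T. Bateman, H. G. Diamond, *Analytic Number Theory*, World Scientific
  2004, Lemma 11.16 (a one-sided bound implies RH; used through `MertensOneSided.lean`).
* [Ingham1942] A. E. Ingham, *On two conjectures in the theory of numbers*, Amer. J. Math. 64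
  (1942) 313–319 (ref. [18] of the paper); [Titchmarsh1986] §14.28–14.29 (ref. [44]).
-/

noncomputable section

open Complex Filter Asymptotics MeasureTheory Set
open scoped Real Topology

namespace Literature.NumberTheory.LFunctions

/-! ## (2.2): a one-sided bound `η M(x) ≤ A √x` controls `1/(s ζ(s))` on `Re s > ½` -/

section OneSided

variable {A η : ℝ}

/-- The defect `M(x) - ηA√x` of a one-sided bound has an absolutely convergent Mellin transform
on `Re s > ½` (Landau's theorem for `M`, `integrableOn_mertens_rpow_of_oneSided`, and the
explicit transform of `√x`). [cite: OdlyzkoTeRiele1985, §2 (2.1)–(2.2) pp. 140–141] -/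
theorem integrableOn_oneSidedDefect_rpow (hη : η = 1 ∨ η = -1)
    (hb : ∀ x, 1 ≤ x → η * (mertensFunction x : ℝ) ≤ A * Real.sqrt x) {σ : ℝ}
    (hσ : 1 / 2 < σ) :
    IntegrableOn (fun x ↦ ((mertensFunction x : ℝ) - η * A * Real.sqrt x) * x ^ (-(σ + 1)))
      (Ioi 1) := by
  have h1 := integrableOn_mertens_rpow_of_oneSided hη (x₁ := 1) hb hσ
  have h2 := (integrableOn_sqrt_mul_rpow hσ).const_mul (η * A)
  refine (h1.sub h2).congr_fun (fun x _ ↦ ?_) measurableSet_Ioi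
  simp only [Pi.sub_apply]
  ring

/-- **Odlyzko–te Riele (2.2), one-sided form.** If `η M(x) ≤ A √x` for all `x ≥ 1`
(`η = ±1`, `A ≥ 0`), then for `½ < Re s < 1`,
`‖1/(s ζ(s))‖ ≤ 2A/(Re s - ½) + ‖1/(σ ζ(σ))‖` with `σ = Re s`: the integral representation
(2.1) `1/(sζ(s)) = ∫_1^∞ M(x) x^{-s-1} dx` holds on `Re s > ½` (Landau; `mellin_mertens_eq_of_integrable`),
and `M = ηA√x - η g` with `g = A√x - ηM ≥ 0`, whose transform at the real point `σ` is
`A/(σ-½) - η/(σζ(σ))`. Under the two-sided Mertens bound `|M(x)| ≤ A√x` the paper's (2.2) reads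
`|1/ζ(s)| ≤ A|s|/(σ-½)`. [cite: OdlyzkoTeRiele1985, §2 (2.2) p. 141] -/
theorem norm_inv_zeta_le_of_oneSided (hη : η = 1 ∨ η = -1) (hA : 0 ≤ A)
    (hb : ∀ x, 1 ≤ x → η * (mertensFunction x : ℝ) ≤ A * Real.sqrt x)
    {s : ℂ} (hs : 1 / 2 < s.re) (hs1 : s.re < 1) :
    ‖1 / (s * riemannZeta s)‖ ≤
      2 * A / (s.re - 1 / 2) + ‖1 / ((s.re : ℂ) * riemannZeta (s.re : ℂ))‖ := by
  set σ : ℝ := s.re with hσdef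
  have hσ : 1 / 2 < σ := hs
  have hη2 : η * η = 1 := by rcases hη with rfl | rfl <;> norm_num
  -- Landau: absolute convergence on `Re s > ½`
  have hI : ∀ σ' : ℝ, 1 / 2 < σ' →
      IntegrableOn (fun x ↦ (mertensFunction x : ℝ) * x ^ (-(σ' + 1))) (Ioi 1) :=
    fun σ' hσ' ↦ integrableOn_mertens_rpow_of_oneSided hη (x₁ := 1) hb hσ'
  have hs_ne : s ≠ 1 := by
    intro h
    have h1 : σ = 1 := by rw [hσdef, h, Complex.one_re]
    linarith
  have hσ_ne : ((σ : ℝ) : ℂ) ≠ 1 := by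
    intro h
    have := congrArg Complex.re h
    simp at this
    linarith
  have hσre : 1 / 2 < ((σ : ℝ) : ℂ).re := by simpa using hσ
  -- the Mellin identities at `s` and at the real point `σ`
  have e1 : Landau.mellinIoi (fun x ↦ (mertensFunction x : ℝ)) s = 1 / (s * riemannZeta s) :=
    mellin_mertens_eq_of_integrable hI hs hs_ne
  have e2 : Landau.mellinIoi (fun x ↦ (mertensFunction x : ℝ)) (σ : ℂ) =
      1 / ((σ : ℂ) * riemannZeta (σ : ℂ)) :=
    mellin_mertens_eq_of_integrable hI hσre hσ_ne
  -- the defect function `g = M - ηA√x` (so that `η g ≤ 0` on `[1, ∞)`)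
  set g : ℝ → ℝ := fun x ↦ (mertensFunction x : ℝ) - η * A * Real.sqrt x with hg
  have hgI : ∀ σ' : ℝ, 1 / 2 < σ' → IntegrableOn (fun x ↦ g x * x ^ (-(σ' + 1))) (Ioi 1) :=
    fun σ' hσ' ↦ integrableOn_oneSidedDefect_rpow hη hb hσ'
  have habs : ∀ x, 1 ≤ x → |g x| = -(η * g x) := by
    intro x hx
    have hηg : η * g x = η * mertensFunction x - A * Real.sqrt x := by
      simp only [hg]
      linear_combination (-(A * Real.sqrt x)) * hη2
    have hle : η * g x ≤ 0 := by rw [hηg]; linarith [hb x hx]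
    have : |g x| = |η * g x| := by
      rcases hη with rfl | rfl <;> simp
    rw [this, abs_of_nonpos hle]
  -- linearity of the transform
  have hlin : ∀ z : ℂ, 1 / 2 < z.re →
      Landau.mellinIoi g z =
        Landau.mellinIoi (fun x ↦ (mertensFunction x : ℝ)) z - η * A * (1 / (z - 1 / 2)) := by
    intro z hz
    have hM : Integrable (fun x : ℝ ↦ ((mertensFunction x : ℝ) : ℂ) * (x : ℂ) ^ (-(z + 1)))
        (volume.restrict (Ioi 1)) := by
      have := Landau.integrable_mellinIntegrand measurable_mertensFunction
        (hI ((1 / 2 + z.re) / 2) (by linarith)) 0 (s := z) (by linarith)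
      refine this.congr (ae_of_all _ fun x ↦ ?_)
      unfold Landau.mellinIntegrand
      rw [pow_zero, one_mul]
    have hS : Integrable (fun x : ℝ ↦ ((η : ℂ) * A) * (((Real.sqrt x : ℝ) : ℂ) * (x : ℂ) ^ (-(z + 1))))
        (volume.restrict (Ioi 1)) :=
      (integrableOn_sqrt_mul_cpow hz).const_mul _
    unfold Landau.mellinIoi
    rw [← integral_sqrt_mul_cpow hz, ← integral_const_mul, ← integral_sub hM hS]
    refine setIntegral_congr_fun measurableSet_Ioi fun x _ ↦ ?_
    simp only [hg]
    push_cast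
    ring
  -- the real point: `∫ |g| x^{-(σ+1)} = -η · mellinIoi g σ`
  have hreal : ∫ x in Ioi (1 : ℝ), |g x| * x ^ (-(σ + 1)) =
      -η * (Landau.mellinIoi g (σ : ℂ)).re := by
    have h0 := Landau.mellinIoiLog_ofReal (g := g) 0 σ
    rw [Landau.mellinIoiLog_zero] at h0
    rw [h0, Complex.ofReal_re, pow_zero, one_mul, ← integral_const_mul]
    refine setIntegral_congr_fun measurableSet_Ioi fun x hx ↦ ?_
    rw [habs x (le_of_lt hx)]
    simp only [pow_zero, mul_one]
    ring
  -- evaluate `mellinIoi g σ`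
  have hgσ : (Landau.mellinIoi g (σ : ℂ)).re =
      (1 / ((σ : ℂ) * riemannZeta (σ : ℂ))).re - η * A * (1 / (σ - 1 / 2)) := by
    rw [hlin _ hσre, e2, Complex.sub_re]
    congr 1
    have : (1 : ℂ) / ((σ : ℂ) - 1 / 2) = ((1 / (σ - 1 / 2) : ℝ) : ℂ) := by push_cast; ring
    rw [this, show (η : ℂ) * (A : ℂ) * (((1 / (σ - 1 / 2) : ℝ)) : ℂ) =
      ((η * A * (1 / (σ - 1 / 2)) : ℝ) : ℂ) by push_cast; ring, Complex.ofReal_re]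
  -- bound at the real point
  have hσpos : 0 < σ - 1 / 2 := by linarith
  have hbound_real : ∫ x in Ioi (1 : ℝ), |g x| * x ^ (-(σ + 1)) ≤
      A / (σ - 1 / 2) + ‖1 / ((σ : ℂ) * riemannZeta (σ : ℂ))‖ := by
    rw [hreal, hgσ]
    have h1 : -η * (1 / ((σ : ℂ) * riemannZeta (σ : ℂ))).re ≤
        ‖1 / ((σ : ℂ) * riemannZeta (σ : ℂ))‖ := by
      have := Complex.abs_re_le_norm (1 / ((σ : ℂ) * riemannZeta (σ : ℂ)))
      have hη1 : |η| = 1 := by rcases hη with rfl | rfl <;> norm_num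
      calc -η * (1 / ((σ : ℂ) * riemannZeta (σ : ℂ))).re
          ≤ |-η * (1 / ((σ : ℂ) * riemannZeta (σ : ℂ))).re| := le_abs_self _
        _ = |(1 / ((σ : ℂ) * riemannZeta (σ : ℂ))).re| := by rw [abs_mul, abs_neg, hη1, one_mul]
        _ ≤ _ := this
    have h2 : -η * (-(η * A * (1 / (σ - 1 / 2)))) = A / (σ - 1 / 2) := by
      rw [show -η * (-(η * A * (1 / (σ - 1 / 2)))) = (η * η) * A / (σ - 1 / 2) by ring, hη2, one_mul]
    linarith [h1, h2]
  -- the complex point: `‖mellin g s‖ ≤ ∫ |g| x^{-(σ+1)}`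
  have hgs : ‖Landau.mellinIoi g s‖ ≤ ∫ x in Ioi (1 : ℝ), |g x| * x ^ (-(σ + 1)) :=
    Landau.norm_mellinIoi_le le_rfl (hgI σ hσ)
  -- `‖ηA/(s-½)‖ ≤ A/(σ-½)`
  have hpole : ‖(η * A : ℂ) * (1 / (s - 1 / 2))‖ ≤ A / (σ - 1 / 2) := by
    have hη1 : ‖(η : ℂ)‖ = 1 := by
      rcases hη with rfl | rfl <;> simp
    rw [norm_mul, norm_mul, hη1, one_mul, Complex.norm_real, Real.norm_eq_abs, abs_of_nonneg hA,
      norm_div, norm_one]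
    have hre : σ - 1 / 2 ≤ ‖s - 1 / 2‖ := by
      have := Complex.abs_re_le_norm (s - 1 / 2)
      have hre' : (s - 1 / 2).re = σ - 1 / 2 := by norm_num [σ]
      rw [hre'] at this
      exact (le_abs_self _).trans this
    rw [mul_one_div]
    exact div_le_div_of_nonneg_left hA hσpos hre
  -- assemble
  have hMs : Landau.mellinIoi (fun x ↦ (mertensFunction x : ℝ)) s =
      Landau.mellinIoi g s + η * A * (1 / (s - 1 / 2)) := by
    rw [hlin s hs]; ring
  calc ‖1 / (s * riemannZeta s)‖
      = ‖Landau.mellinIoi g s + η * A * (1 / (s - 1 / 2))‖ := by rw [← e1, hMs]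
    _ ≤ ‖Landau.mellinIoi g s‖ + ‖(η * A : ℂ) * (1 / (s - 1 / 2))‖ := norm_add_le _ _
    _ ≤ (A / (σ - 1 / 2) + ‖1 / ((σ : ℂ) * riemannZeta (σ : ℂ))‖) + A / (σ - 1 / 2) :=
        add_le_add (hgs.trans hbound_real) hpole
    _ = 2 * A / (σ - 1 / 2) + ‖1 / ((σ : ℂ) * riemannZeta (σ : ℂ))‖ := by ring

/-- **(2.2) as printed.** Under the Mertens bound `|M(x)| ≤ √x` (`x ≥ 1`), for `Re s > ½`,
`s ≠ 1`: `|1/ζ(s)| ≤ |s| ∫_1^∞ x^{1/2} x^{-σ-1} dx = |s|/(σ - ½)`. (In Lean `1/ζ(1)` is a junk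
value, whence `s ≠ 1`; in print `1/ζ` vanishes there.) [cite: OdlyzkoTeRiele1985, §2 (2.2) p. 141] -/
theorem norm_inv_zeta_le_of_mertens_bound
    (hM : ∀ x, 1 ≤ x → |(mertensFunction x : ℝ)| ≤ Real.sqrt x)
    {s : ℂ} (hs : 1 / 2 < s.re) (hs1 : s ≠ 1) :
    ‖1 / riemannZeta s‖ ≤ ‖s‖ / (s.re - 1 / 2) := by
  set σ : ℝ := s.re with hσdef
  have hσ : 1 / 2 < σ := hs
  have hb : ∀ x, 1 ≤ x → (1 : ℝ) * (mertensFunction x : ℝ) ≤ 1 * Real.sqrt x := fun x hx ↦ by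
    rw [one_mul, one_mul]; exact (le_abs_self _).trans (hM x hx)
  have hI : ∀ σ' : ℝ, 1 / 2 < σ' →
      IntegrableOn (fun x ↦ (mertensFunction x : ℝ) * x ^ (-(σ' + 1))) (Ioi 1) :=
    fun σ' hσ' ↦ integrableOn_mertens_rpow_of_oneSided (Or.inl rfl) (x₁ := 1) hb hσ'
  have e1 : Landau.mellinIoi (fun x ↦ (mertensFunction x : ℝ)) s = 1 / (s * riemannZeta s) :=
    mellin_mertens_eq_of_integrable hI hs hs1
  have hζ : riemannZeta s ≠ 0 := riemannZeta_ne_zero_of_mertens_integrable hI hs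
  have hs0 : s ≠ 0 := by rintro rfl; simp [σ] at hσ; linarith
  -- `‖1/(sζ(s))‖ ≤ ∫ |M| x^{-(σ+1)} ≤ ∫ √x x^{-(σ+1)} = 1/(σ-½)`
  have h1 : ‖1 / (s * riemannZeta s)‖ ≤ ∫ x in Ioi (1 : ℝ), |(mertensFunction x : ℝ)| * x ^ (-(σ + 1)) := by
    rw [← e1]; exact Landau.norm_mellinIoi_le le_rfl (hI σ hσ)
  have h2 : ∫ x in Ioi (1 : ℝ), |(mertensFunction x : ℝ)| * x ^ (-(σ + 1)) ≤
      ∫ x in Ioi (1 : ℝ), Real.sqrt x * x ^ (-(σ + 1)) := by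
    refine setIntegral_mono_on ?_ (integrableOn_sqrt_mul_rpow hσ) measurableSet_Ioi fun x hx ↦ ?_
    · have hn : IntegrableOn (fun x ↦ ‖(mertensFunction x : ℝ) * x ^ (-(σ + 1))‖) (Ioi 1) :=
        (hI σ hσ).norm
      refine hn.congr_fun (fun x hx ↦ ?_) measurableSet_Ioi
      have hx0 : 0 < x := zero_lt_one.trans hx
      simp only
      rw [norm_mul, Real.norm_eq_abs, Real.norm_eq_abs, abs_of_pos (Real.rpow_pos_of_pos hx0 _)]
    · have hx0 : 0 < x := zero_lt_one.trans hx
      exact mul_le_mul_of_nonneg_right (hM x hx.le) (Real.rpow_pos_of_pos hx0 _).le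
  have h3 : ∫ x in Ioi (1 : ℝ), Real.sqrt x * x ^ (-(σ + 1)) = 1 / (σ - 1 / 2) := by
    have heq : EqOn (fun x : ℝ ↦ Real.sqrt x * x ^ (-(σ + 1))) (fun x : ℝ ↦ x ^ (-(σ + 1 / 2)))
        (Ioi 1) := by
      intro x hx
      have hx0 : 0 < x := zero_lt_one.trans hx
      simp only
      rw [Real.sqrt_eq_rpow, ← Real.rpow_add hx0]
      congr 1; ring
    rw [setIntegral_congr_fun measurableSet_Ioi heq, integral_Ioi_rpow_of_lt (by linarith) zero_lt_one]
    rw [Real.one_rpow]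
    have : -(σ + 1 / 2) + 1 = -(σ - 1 / 2) := by ring
    rw [this, neg_div_neg_eq]
  have h4 : ‖1 / (s * riemannZeta s)‖ ≤ 1 / (σ - 1 / 2) := h1.trans (h2.trans h3.le)
  have hσpos : 0 < σ - 1 / 2 := by linarith
  have hns : 0 < ‖s‖ := norm_pos_iff.2 hs0
  calc ‖1 / riemannZeta s‖ = ‖s‖ * ‖1 / (s * riemannZeta s)‖ := by
        rw [← norm_mul]; congr 1; field_simp
    _ ≤ ‖s‖ * (1 / (σ - 1 / 2)) := mul_le_mul_of_nonneg_left h4 hns.le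
    _ = ‖s‖ / (σ - 1 / 2) := by ring

/-! ## RH and the simplicity of the zeros from a one-sided bound -/

/-- **A one-sided bound implies RH** (Odlyzko–te Riele §2, p. 141, hypotheses (i)/(ii), after
Ingham [18] and Titchmarsh [44]; Bateman–Diamond Lemma 11.16): if `η M(x) ≤ A √x` for
`x ≥ x₁` (`η = ±1`), every zero of `ζ` in the critical strip has real part `½` (no zeros on
`Re s > ½` by Landau's theorem, `riemannZeta_ne_zero_of_mertens_integrable`; none on `Re s < ½`
by the functional equation). [cite: OdlyzkoTeRiele1985, §2 p. 141 (i)–(ii)] -/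
theorem zetaZero_re_eq_half_of_oneSided (hη : η = 1 ∨ η = -1) {x₁ : ℝ}
    (hb : ∀ x, x₁ ≤ x → η * (mertensFunction x : ℝ) ≤ A * Real.sqrt x)
    {ρ : ℂ} (hζ : riemannZeta ρ = 0) (h0 : 0 < ρ.re) (h1 : ρ.re < 1) : ρ.re = 1 / 2 := by
  have hI : ∀ σ : ℝ, 1 / 2 < σ →
      IntegrableOn (fun x ↦ (mertensFunction x : ℝ) * x ^ (-(σ + 1))) (Ioi 1) :=
    fun σ hσ ↦ integrableOn_mertens_rpow_of_oneSided hη hb hσ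
  have hright : ∀ s : ℂ, 1 / 2 < s.re → riemannZeta s ≠ 0 :=
    fun s hs ↦ riemannZeta_ne_zero_of_mertens_integrable hI hs
  rcases lt_trichotomy ρ.re (1 / 2) with h | h | h
  · exfalso
    have hρn : ∀ n : ℕ, ρ ≠ -n := by
      intro n hn
      have := congrArg Complex.re hn
      simp at this
      linarith
    have hρ1 : ρ ≠ 1 := by
      intro h1'
      rw [h1'] at h1
      simp at h1
    have h1ρ : riemannZeta (1 - ρ) = 0 := by
      rw [riemannZeta_one_sub hρn hρ1, hζ, mul_zero]
    exact hright (1 - ρ) (by simp; linarith) h1ρ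
  · exact h
  · exact absurd hζ (hright ρ h)

/-- A zero `ρ ≠ 1` of `ζ` at which `ζ'` also vanishes is a zero of order at least two:
`‖ζ(z)‖ ≤ C ‖z - ρ‖²` near `ρ` (twice the `dslope` of the analytic function `ζ`). [folklore] -/
theorem norm_riemannZeta_le_sq_of_deriv_eq_zero {ρ : ℂ} (hρ1 : ρ ≠ 1)
    (hζ : riemannZeta ρ = 0) (hd : deriv riemannZeta ρ = 0) :
    ∃ C δ : ℝ, 0 < δ ∧ ∀ z : ℂ, ‖z - ρ‖ < δ → ‖riemannZeta z‖ ≤ C * ‖z - ρ‖ ^ 2 := by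
  have ha : AnalyticAt ℂ riemannZeta ρ := by
    refine DifferentiableOn.analyticAt (s := {(1 : ℂ)}ᶜ)
      (fun z hz ↦ (differentiableAt_riemannZeta hz).differentiableWithinAt) ?_
    exact isOpen_compl_singleton.mem_nhds hρ1
  obtain ⟨p, hp⟩ := ha
  set g₁ : ℂ → ℂ := dslope riemannZeta ρ with hg₁
  have hq' : HasFPowerSeriesAt g₁ p.fslope ρ := hp.has_fpower_series_dslope_fslope
  set g₂ : ℂ → ℂ := dslope g₁ ρ with hg₂
  have hg₂a : AnalyticAt ℂ g₂ ρ := ⟨_, hq'.has_fpower_series_dslope_fslope⟩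
  have hc : ContinuousAt g₂ ρ := hg₂a.continuousAt
  obtain ⟨δ, hδ, hB⟩ : ∃ δ > 0, ∀ z : ℂ, ‖z - ρ‖ < δ → ‖g₂ z‖ ≤ ‖g₂ ρ‖ + 1 := by
    obtain ⟨δ, hδ, h⟩ := Metric.continuousAt_iff.1 hc 1 one_pos
    refine ⟨δ, hδ, fun z hz ↦ ?_⟩
    have h' : dist (g₂ z) (g₂ ρ) < 1 := h (by rwa [dist_eq_norm])
    rw [dist_eq_norm] at h'
    calc ‖g₂ z‖ = ‖(g₂ z - g₂ ρ) + g₂ ρ‖ := by rw [sub_add_cancel]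
      _ ≤ ‖g₂ z - g₂ ρ‖ + ‖g₂ ρ‖ := norm_add_le _ _
      _ ≤ ‖g₂ ρ‖ + 1 := by linarith
  refine ⟨‖g₂ ρ‖ + 1, δ, hδ, fun z hz ↦ ?_⟩
  have e1 : riemannZeta z = (z - ρ) * g₁ z := by
    have := sub_smul_dslope riemannZeta ρ z
    rw [smul_eq_mul, hζ, sub_zero] at this
    exact this.symm
  have h0 : g₁ ρ = 0 := by rw [hg₁, dslope_same, hd]
  have e2 : g₁ z = (z - ρ) * g₂ z := by
    have := sub_smul_dslope g₁ ρ z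
    rw [smul_eq_mul, h0, sub_zero] at this
    exact this.symm
  rw [e1, e2, ← mul_assoc, norm_mul, norm_mul, ← pow_two, mul_comm]
  exact mul_le_mul_of_nonneg_right (hB z hz) (by positivity)

/-- `1/(σ ζ(σ))` is bounded on `[½, ¾]` (`ζ(σ) < 0` on `(0,1)`, continuity). [folklore] -/
theorem exists_bound_inv_zeta_real :
    ∃ C₀ : ℝ, ∀ σ : ℝ, σ ∈ Icc (1 / 2 : ℝ) (3 / 4) →
      ‖1 / ((σ : ℂ) * riemannZeta (σ : ℂ))‖ ≤ C₀ := by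
  have hcont : ContinuousOn (fun σ : ℝ ↦ 1 / ((σ : ℂ) * riemannZeta (σ : ℂ)))
      (Icc (1 / 2) (3 / 4)) := by
    refine fun σ hσ ↦ ContinuousAt.continuousWithinAt ?_
    have hσ1 : (σ : ℂ) ≠ 1 := by
      intro h
      have := congrArg Complex.re h
      simp at this
      linarith [hσ.2]
    have hζ : riemannZeta (σ : ℂ) ≠ 0 :=
      riemannZeta_ofReal_ne_zero_of_pos_of_lt_one σ (by linarith [hσ.1]) (by linarith [hσ.2])
    have hσ0 : (σ : ℂ) ≠ 0 := by
      have : σ ≠ 0 := by linarith [hσ.1]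
      exact_mod_cast this
    refine ContinuousAt.div continuousAt_const ?_ (mul_ne_zero hσ0 hζ)
    exact Complex.continuous_ofReal.continuousAt.mul
      ((differentiableAt_riemannZeta hσ1).continuousAt.comp Complex.continuous_ofReal.continuousAt)
  obtain ⟨C₀, hC₀⟩ := isCompact_Icc.exists_bound_of_continuousOn hcont
  exact ⟨C₀, hC₀⟩

/-- **A one-sided bound implies that all zeros are simple** (Odlyzko–te Riele §2, p. 141: "This
would imply that the zeta function does not have any multiple zeros, since if `σ = ½ + iγ` were
a zero of multiplicity `k`, then for some constant `a > 0`, `|ζ(½ + u + iγ)| ~ a u^k` as `u → 0⁺`,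
which is inconsistent with (2.2) for `k ≥ 2`"; "the assumption that `|M(x)| < A x^{1/2}` for any
fixed `A` … would have sufficed", and RH and simplicity "follow from any one of"
(i) `limsup M(x)x^{-1/2} < A`, (ii) `liminf M(x)x^{-1/2} > -A`). The zero clause of the kernel
theorem at every height: if `η M(x) ≤ A√x` for `x ≥ x₁` (`η = ±1`), every zero of `ζ` with
`0 < Re ρ < 1` has `Re ρ = ½` and `ζ'(ρ) ≠ 0`. [cite: OdlyzkoTeRiele1985, §2 (2.2) p. 141 and (i)–(ii)] -/
theorem zetaZeros_simple_onLine_of_oneSided (hη : η = 1 ∨ η = -1) {x₁ : ℝ}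
    (hb : ∀ x, x₁ ≤ x → η * (mertensFunction x : ℝ) ≤ A * Real.sqrt x) :
    ∀ ρ : ℂ, riemannZeta ρ = 0 → 0 < ρ.re → ρ.re < 1 →
      ρ.re = 1 / 2 ∧ deriv riemannZeta ρ ≠ 0 := by
  have hη1 : |η| = 1 := by rcases hη with rfl | rfl <;> norm_num
  -- normalise to a bound on `[1, ∞)` with a non-negative constant
  set A' : ℝ := max A 0 + Real.sqrt (max x₁ 1) with hA'
  have hA'0 : 0 ≤ A' := by positivity
  have hAA' : A ≤ A' := (le_max_left A 0).trans (le_add_of_nonneg_right (Real.sqrt_nonneg _))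
  have hsA' : Real.sqrt (max x₁ 1) ≤ A' := le_add_of_nonneg_left (le_max_right A 0)
  have hb' : ∀ x, 1 ≤ x → η * (mertensFunction x : ℝ) ≤ A' * Real.sqrt x := by
    intro x hx
    have hsx : 0 ≤ Real.sqrt x := Real.sqrt_nonneg x
    rcases le_or_gt x₁ x with hx₁ | hx₁
    · exact (hb x hx₁).trans (mul_le_mul_of_nonneg_right hAA' hsx)
    · have hM : |(mertensFunction x : ℝ)| ≤ x := abs_mertensFunction_le (by linarith)
      have hηM : η * (mertensFunction x : ℝ) ≤ x := by
        refine (le_abs_self _).trans ?_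
        rwa [abs_mul, hη1, one_mul]
      calc η * (mertensFunction x : ℝ) ≤ x := hηM
        _ = Real.sqrt x * Real.sqrt x := (Real.mul_self_sqrt (by linarith)).symm
        _ ≤ Real.sqrt (max x₁ 1) * Real.sqrt x :=
            mul_le_mul_of_nonneg_right (Real.sqrt_le_sqrt (le_max_of_le_left hx₁.le)) hsx
        _ ≤ A' * Real.sqrt x := mul_le_mul_of_nonneg_right hsA' hsx
  have hI : ∀ σ : ℝ, 1 / 2 < σ →
      IntegrableOn (fun x ↦ (mertensFunction x : ℝ) * x ^ (-(σ + 1))) (Ioi 1) :=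
    fun σ hσ ↦ integrableOn_mertens_rpow_of_oneSided hη (x₁ := 1) hb' hσ
  intro ρ hζ h0 h1
  have hre : ρ.re = 1 / 2 := zetaZero_re_eq_half_of_oneSided hη hb hζ h0 h1
  refine ⟨hre, fun hd ↦ ?_⟩
  have hρ1 : ρ ≠ 1 := by
    intro h
    rw [h] at h1
    simp at h1
  obtain ⟨C, δ, hδ, hC⟩ := norm_riemannZeta_le_sq_of_deriv_eq_zero hρ1 hζ hd
  obtain ⟨C₀, hC₀⟩ := exists_bound_inv_zeta_real
  have hC0 : 0 ≤ C := by
    have hz : ‖((ρ + (δ / 2 : ℝ)) : ℂ) - ρ‖ = δ / 2 := by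
      rw [add_sub_cancel_left, Complex.norm_real, Real.norm_eq_abs, abs_of_pos (by positivity)]
    have := hC (ρ + (δ / 2 : ℝ)) (by rw [hz]; linarith)
    rw [hz] at this
    have h2 : (0 : ℝ) < (δ / 2) ^ 2 := by positivity
    nlinarith [norm_nonneg (riemannZeta (ρ + (δ / 2 : ℝ)))]
  have hC₀0 : 0 ≤ C₀ := (norm_nonneg _).trans (hC₀ (1 / 2) ⟨le_rfl, by norm_num⟩)
  set L : ℝ := (‖ρ‖ + 1) * C * (2 * A' + C₀) + 1 with hL
  have hL0 : 0 < L := by positivity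
  -- the abscissa offset `u`
  set u : ℝ := min (δ / 2) (min (1 / 4) (1 / (2 * L))) with hu
  have hu0 : 0 < u := by positivity
  have huδ : u < δ := (min_le_left _ _).trans_lt (by linarith)
  have hu4 : u ≤ 1 / 4 := (min_le_right _ _).trans (min_le_left _ _)
  have huL : u ≤ 1 / (2 * L) := (min_le_right _ _).trans (min_le_right _ _)
  set s : ℂ := ρ + (u : ℂ) with hs
  have hsρ : s - ρ = (u : ℂ) := by rw [hs, add_sub_cancel_left]
  have hsre : s.re = 1 / 2 + u := by rw [hs, Complex.add_re, hre, Complex.ofReal_re]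
  have hs1 : 1 / 2 < s.re := by rw [hsre]; linarith
  have hs2 : s.re < 1 := by rw [hsre]; linarith
  -- the lower bound (2.2) at `s`
  have hmain := norm_inv_zeta_le_of_oneSided hη hA'0 hb' hs1 hs2
  rw [hsre, show 1 / 2 + u - 1 / 2 = u by ring] at hmain
  have hσmem : (1 / 2 + u) ∈ Icc (1 / 2 : ℝ) (3 / 4) := ⟨by linarith, by linarith⟩
  have hmain' : ‖1 / (s * riemannZeta s)‖ ≤ 2 * A' / u + C₀ := by
    have := hC₀ _ hσmem
    linarith
  -- the upper bound at `s` from the double zero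
  have hzs : ‖riemannZeta s‖ ≤ C * u ^ 2 := by
    have hn : ‖s - ρ‖ = u := by rw [hsρ, Complex.norm_real, Real.norm_eq_abs, abs_of_pos hu0]
    have := hC s (by rw [hn]; exact huδ)
    rwa [hn] at this
  -- non-vanishing at `s`
  have hζs : riemannZeta s ≠ 0 := riemannZeta_ne_zero_of_mertens_integrable hI hs1
  have hs0 : s ≠ 0 := by
    intro h
    rw [h] at hs1
    simp at hs1
    linarith
  have hsn : ‖s‖ ≤ ‖ρ‖ + 1 := by
    rw [hs]
    refine (norm_add_le _ _).trans ?_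
    rw [Complex.norm_real, Real.norm_eq_abs, abs_of_pos hu0]
    linarith
  -- `1 = ‖sζ(s)‖ ‖1/(sζ(s))‖ ≤ (‖ρ‖+1) C u² (2A'/u + C₀) ≤ (L-1) u < 1`
  have hprod : (1 : ℝ) ≤ (‖ρ‖ + 1) * (C * u ^ 2) * (2 * A' / u + C₀) := by
    have h1 : (1 : ℝ) = ‖s * riemannZeta s‖ * ‖1 / (s * riemannZeta s)‖ := by
      rw [← norm_mul, mul_one_div_cancel (mul_ne_zero hs0 hζs), norm_one]
    have h2 : ‖s‖ * ‖riemannZeta s‖ ≤ (‖ρ‖ + 1) * (C * u ^ 2) :=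
      mul_le_mul hsn hzs (norm_nonneg _) (by positivity)
    calc (1 : ℝ) = ‖s * riemannZeta s‖ * ‖1 / (s * riemannZeta s)‖ := h1
      _ = ‖s‖ * ‖riemannZeta s‖ * ‖1 / (s * riemannZeta s)‖ := by rw [norm_mul]
      _ ≤ (‖ρ‖ + 1) * (C * u ^ 2) * (2 * A' / u + C₀) :=
          mul_le_mul h2 hmain' (norm_nonneg _) (by positivity)
  have hkey : (‖ρ‖ + 1) * (C * u ^ 2) * (2 * A' / u + C₀) ≤ (L - 1) * u := by
    have hu1 : u ≤ 1 := by linarith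
    have e : (‖ρ‖ + 1) * (C * u ^ 2) * (2 * A' / u + C₀) =
        (‖ρ‖ + 1) * C * (2 * A' + C₀ * u) * u := by
      field_simp
    rw [e, show L - 1 = (‖ρ‖ + 1) * C * (2 * A' + C₀) by rw [hL]; ring]
    apply mul_le_mul_of_nonneg_right _ hu0.le
    apply mul_le_mul_of_nonneg_left _ (by positivity)
    nlinarith
  have hfin : (L - 1) * u < 1 := by
    have : L * u ≤ 1 / 2 := by
      calc L * u ≤ L * (1 / (2 * L)) := mul_le_mul_of_nonneg_left huL hL0.le
        _ = 1 / 2 := by field_simp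
    nlinarith
  linarith

/-! ## The `rh.S22` statements from Table 3 alone -/

/-- Under a one-sided bound the zero clause of `OdlyzkoTeRiele1985_numerics` is free, so Table 3
supplies the whole numerical fact. [cite: OdlyzkoTeRiele1985, §2 p. 141 and §4.3 p. 155] -/
theorem OdlyzkoTeRiele1985_numerics_of_table3_of_oneSided (hη : η = 1 ∨ η = -1) {x₁ : ℝ}
    (hb : ∀ x, x₁ ≤ x → η * (mertensFunction x : ℝ) ≤ A * Real.sqrt x)
    (h : OdlyzkoTeRiele1985_table3) : OdlyzkoTeRiele1985_numerics := by
  obtain ⟨T, hT₁, hT₂, h₁, h₂⟩ := h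
  exact ⟨T, by linarith, fun ρ hζ h0 h1 _ ↦ zetaZeros_simple_onLine_of_oneSided hη hb ρ hζ h0 h1,
    h₁, h₂⟩

end OneSided

/-- **`limsup M(x)x^{-1/2} > 1.06` from Table 3 alone.** If the conclusion failed, `M(x) ≤ 2√x`
eventually — a one-sided bound, under which the zeros are on the line and simple (§2), so the
kernel theorem (proved: `OdlyzkoTeRiele1985_kernelTheorem_holds`) and line 15 of Table 3 give
`limsup > 1.06` after all. Brent's zero verification is not needed. [cite: OdlyzkoTeRiele1985, §1 p. 139, §2 p. 141, §4.3 p. 155] -/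
theorem odlyzko_te_riele_limsup_of_table3' (h : OdlyzkoTeRiele1985_table3) :
    odlyzko_te_riele_limsup := by
  by_contra hneg
  have hnf : ¬ ∃ᶠ x : ℝ in atTop, 2 * Real.sqrt x < mertensFunction x :=
    fun hf ↦ hneg ⟨2, by norm_num, hf⟩
  have hev : ∀ᶠ x : ℝ in atTop, (mertensFunction x : ℝ) ≤ 2 * Real.sqrt x := by
    simpa [Filter.not_frequently, not_lt] using hnf
  obtain ⟨x₁, hx₁⟩ := Filter.eventually_atTop.1 hev
  have hb : ∀ x, x₁ ≤ x → (1 : ℝ) * (mertensFunction x : ℝ) ≤ 2 * Real.sqrt x := fun x hx ↦ by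
    rw [one_mul]; exact hx₁ x hx
  exact hneg (odlyzko_te_riele_limsup_of_numerics
    (OdlyzkoTeRiele1985_numerics_of_table3_of_oneSided (Or.inl rfl) hb h))

/-- **`liminf M(x)x^{-1/2} < -1.009` from Table 3 alone** (dually, via hypothesis (ii)). [cite: OdlyzkoTeRiele1985, §1 p. 139, §2 p. 141, §4.3 p. 155] -/
theorem odlyzko_te_riele_liminf_of_table3' (h : OdlyzkoTeRiele1985_table3) :
    odlyzko_te_riele_liminf := by
  by_contra hneg
  have hnf : ¬ ∃ᶠ x : ℝ in atTop, (mertensFunction x : ℝ) < (-2) * Real.sqrt x :=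
    fun hf ↦ hneg ⟨-2, by norm_num, hf⟩
  have hev : ∀ᶠ x : ℝ in atTop, (-2) * Real.sqrt x ≤ (mertensFunction x : ℝ) := by
    simpa [Filter.not_frequently, not_lt] using hnf
  obtain ⟨x₁, hx₁⟩ := Filter.eventually_atTop.1 hev
  have hb : ∀ x, x₁ ≤ x → (-1 : ℝ) * (mertensFunction x : ℝ) ≤ 2 * Real.sqrt x := fun x hx ↦ by
    have := hx₁ x hx; linarith
  exact hneg (odlyzko_te_riele_liminf_of_numerics
    (OdlyzkoTeRiele1985_numerics_of_table3_of_oneSided (Or.inr rfl) hb h))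

/-- **The Mertens conjecture is false, from Table 3 alone**: of the printed proof, only the two
values of `h_K` in Table 3 (a certified 2000-zero computation) remain unproved in the tree; the
kernel theorem, the Jurkat–Peyerimhoff kernel, and — by §2 — the location and simplicity of the
zeros below `T` under the negation of the conclusion are all theorems. [cite: OdlyzkoTeRiele1985, p. 155 with §2 p. 141] -/
theorem not_mertens_conjecture_of_table3' (h : OdlyzkoTeRiele1985_table3) :
    not_mertens_conjecture :=
  not_mertens_conjecture_of_limsup (odlyzko_te_riele_limsup_of_table3' h)

/-- The zero clause under the Mertens conjecture itself (the two-sided case of §2): if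
`|M(x)| < √x` for `x > 1` then every zero of `ζ` in the critical strip is on the line and simple.
[cite: OdlyzkoTeRiele1985, §2 (2.2) p. 141] -/
theorem zetaZeros_simple_onLine_of_mertensConjecture
    (hM : ∀ x : ℝ, 1 < x → |(mertensFunction x : ℝ)| < Real.sqrt x) :
    ∀ ρ : ℂ, riemannZeta ρ = 0 → 0 < ρ.re → ρ.re < 1 →
      ρ.re = 1 / 2 ∧ deriv riemannZeta ρ ≠ 0 := by
  refine zetaZeros_simple_onLine_of_oneSided (η := 1) (A := 1) (x₁ := 2) (Or.inl rfl) fun x hx ↦ ?_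
  rw [one_mul, one_mul]
  exact (le_abs_self _).trans (hM x (by linarith)).le

/-! ## What remains to be computed: the values of `h_K` under RH and simplicity

By the preceding section the zero clause is available for free inside any proof of an rh.S22
statement by contradiction. The following interfaces record the exact residual input: a certified
evaluation of `Re h_K(y)` which may *assume* that every zero of `ζ` in the critical strip is on the
line and simple (so that the zeros below `T` are `½ ± iγ_j` with the `γ_j` located by sign changes
on the critical line, and `h_K` is the printed finite trigonometric sum). -/

/-- **`limsup M(x)x^{-1/2} > 1.06` from a conditional evaluation of `h_K`.** It suffices to
produce, *assuming* that all zeros of `ζ` in `0 < Re s < 1` are on the critical line and simple,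
a height `T > 0` and a `y` with `Re h_K(y) > 1.06` for the Jurkat–Peyerimhoff weight
`k(t) = g(t/T)`. [cite: OdlyzkoTeRiele1985, §2 p. 141 with Theorem p. 144 and (4.1) p. 150] -/
theorem odlyzko_te_riele_limsup_of_conditional
    (h : (∀ ρ : ℂ, riemannZeta ρ = 0 → 0 < ρ.re → ρ.re < 1 →
        ρ.re = 1 / 2 ∧ deriv riemannZeta ρ ≠ 0) →
      ∃ T : ℝ, 0 < T ∧ ∃ y : ℝ, (1.06 : ℝ) <
        (inghamSum (fun t : ℝ => (jurkatPeyerimhoffKernel (t / T) : ℂ)) T y).re) :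
    odlyzko_te_riele_limsup := by
  by_contra hneg
  have hnf : ¬ ∃ᶠ x : ℝ in atTop, 2 * Real.sqrt x < mertensFunction x :=
    fun hf ↦ hneg ⟨2, by norm_num, hf⟩
  have hev : ∀ᶠ x : ℝ in atTop, (mertensFunction x : ℝ) ≤ 2 * Real.sqrt x := by
    simpa [Filter.not_frequently, not_lt] using hnf
  obtain ⟨x₁, hx₁⟩ := Filter.eventually_atTop.1 hev
  have hb : ∀ x, x₁ ≤ x → (1 : ℝ) * (mertensFunction x : ℝ) ≤ 2 * Real.sqrt x := fun x hx ↦ by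
    rw [one_mul]; exact hx₁ x hx
  have hz := zetaZeros_simple_onLine_of_oneSided (Or.inl rfl) hb
  obtain ⟨T, hT, y, hy⟩ := h hz
  have hk := (kernelTheorem_jurkatPeyerimhoff OdlyzkoTeRiele1985_kernelTheorem_holds
    jurkatPeyerimhoffKernel_admissible_holds hT (fun ρ hζ h0 h1 _ ↦ hz ρ hζ h0 h1) y).1
  set r : ℝ := (inghamSum (fun t : ℝ => (jurkatPeyerimhoffKernel (t / T) : ℂ)) T y).re
  exact hneg ⟨(1.06 + r) / 2, by linarith, hk _ (by linarith)⟩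

/-- **`liminf M(x)x^{-1/2} < -1.009` from a conditional evaluation of `h_K`** (dually).
[cite: OdlyzkoTeRiele1985, §2 p. 141 with Theorem p. 144 and (4.1) p. 150] -/
theorem odlyzko_te_riele_liminf_of_conditional
    (h : (∀ ρ : ℂ, riemannZeta ρ = 0 → 0 < ρ.re → ρ.re < 1 →
        ρ.re = 1 / 2 ∧ deriv riemannZeta ρ ≠ 0) →
      ∃ T : ℝ, 0 < T ∧ ∃ y : ℝ,
        (inghamSum (fun t : ℝ => (jurkatPeyerimhoffKernel (t / T) : ℂ)) T y).re < -1.009) :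
    odlyzko_te_riele_liminf := by
  by_contra hneg
  have hnf : ¬ ∃ᶠ x : ℝ in atTop, (mertensFunction x : ℝ) < (-2) * Real.sqrt x :=
    fun hf ↦ hneg ⟨-2, by norm_num, hf⟩
  have hev : ∀ᶠ x : ℝ in atTop, (-2) * Real.sqrt x ≤ (mertensFunction x : ℝ) := by
    simpa [Filter.not_frequently, not_lt] using hnf
  obtain ⟨x₁, hx₁⟩ := Filter.eventually_atTop.1 hev
  have hb : ∀ x, x₁ ≤ x → (-1 : ℝ) * (mertensFunction x : ℝ) ≤ 2 * Real.sqrt x := fun x hx ↦ by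
    have := hx₁ x hx; linarith
  have hz := zetaZeros_simple_onLine_of_oneSided (Or.inr rfl) hb
  obtain ⟨T, hT, y, hy⟩ := h hz
  have hk := (kernelTheorem_jurkatPeyerimhoff OdlyzkoTeRiele1985_kernelTheorem_holds
    jurkatPeyerimhoffKernel_admissible_holds hT (fun ρ hζ h0 h1 _ ↦ hz ρ hζ h0 h1) y).2
  set r : ℝ := (inghamSum (fun t : ℝ => (jurkatPeyerimhoffKernel (t / T) : ℂ)) T y).re
  exact hneg ⟨(-1.009 + r) / 2, by linarith, hk _ (by linarith)⟩

/-- **The Mertens conjecture is false as soon as, assuming its own consequences (RH and simple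
zeros, §2), some `Re h_K(y)` exceeds `1` in absolute value** — the minimal residual computation
for `not_mertens_conjecture` (rh.S22): under `|M(x)| < √x (x > 1)` the zeros are on the line and
simple (`zetaZeros_simple_onLine_of_mertensConjecture`), the kernel theorem gives
`limsup m ≥ Re h_K(y)` and `liminf m ≤ Re h_K(y)`, while `|m| ≤ 1`. [cite: OdlyzkoTeRiele1985, §2 p. 141, Theorem p. 144, (1.3) p. 139] -/
theorem not_mertens_conjecture_of_conditional
    (h : (∀ ρ : ℂ, riemannZeta ρ = 0 → 0 < ρ.re → ρ.re < 1 →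
        ρ.re = 1 / 2 ∧ deriv riemannZeta ρ ≠ 0) →
      ∃ T : ℝ, 0 < T ∧ ∃ y : ℝ,
        1 < (inghamSum (fun t : ℝ => (jurkatPeyerimhoffKernel (t / T) : ℂ)) T y).re ∨
        (inghamSum (fun t : ℝ => (jurkatPeyerimhoffKernel (t / T) : ℂ)) T y).re < -1) :
    not_mertens_conjecture := by
  intro hM
  have hz := zetaZeros_simple_onLine_of_mertensConjecture hM
  obtain ⟨T, hT, y, hy⟩ := h hz
  have hk := kernelTheorem_jurkatPeyerimhoff OdlyzkoTeRiele1985_kernelTheorem_holds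
    jurkatPeyerimhoffKernel_admissible_holds hT (fun ρ hζ h0 h1 _ ↦ hz ρ hζ h0 h1) y
  set r : ℝ := (inghamSum (fun t : ℝ => (jurkatPeyerimhoffKernel (t / T) : ℂ)) T y).re
  rcases hy with hy | hy
  · have hfr := hk.1 ((1 + r) / 2) (by linarith)
    refine not_mertens_conjecture_of_frequently ?_ hM
    refine (hfr.and_eventually (eventually_ge_atTop 0)).mono fun x ⟨hx, hx0⟩ ↦ ?_
    have hs : 0 ≤ Real.sqrt x := Real.sqrt_nonneg x
    calc Real.sqrt x ≤ (1 + r) / 2 * Real.sqrt x := by nlinarith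
      _ < mertensFunction x := hx
      _ ≤ |(mertensFunction x : ℝ)| := le_abs_self _
  · have hfr := hk.2 ((-1 + r) / 2) (by linarith)
    refine not_mertens_conjecture_of_frequently ?_ hM
    refine (hfr.and_eventually (eventually_ge_atTop 0)).mono fun x ⟨hx, hx0⟩ ↦ ?_
    have hs : 0 ≤ Real.sqrt x := Real.sqrt_nonneg x
    calc Real.sqrt x ≤ -((-1 + r) / 2 * Real.sqrt x) := by nlinarith
      _ < -(mertensFunction x : ℝ) := by linarith
      _ ≤ |(mertensFunction x : ℝ)| := neg_le_abs _

end Literature.NumberTheory.LFunctions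

end
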